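import Summits.QuantumFields.YangMills.Theorems.RenyiTelescopePlaquetteTransport
import Literature.MathematicalPhysics.QuantumFieldTheory.Balaban1983to89.T3HistoryTailReduction
import Literature.MathematicalPhysics.QuantumFieldTheory.Balaban1983to89.T3CruxEstimates

/-!
# The level-shift bootstrap, part 2: transport of plaquette events and interior complements to the base family — helper toward
# `LevelShiftBootstrap.HistoryTailOfLocalStability` (stmt-QuantumFields-26949), route-independent (no `Theses` import)

Width seat `ym-line-sfw-p2-w3` g22 (home cell `ym-idea-1`), `--supports stmt-QuantumFields-26949`.

WHAT.  The cross-ratio chain of route `LevelShiftBootstrap` lives on the refined families `F.refine d` at couplings `γL^{-d}`; its base, its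
conclusion and its conditioning defects are read on the ORIGINAL family `F` (run `J + d`), where ONE per-plaquette tail predicate indexed by
(run, level) carries the whole induction.  This file supplies the three identifications, all instances of the landed event-free transport
`RenyiTelescope.gibbsK_real_eq_refine` (same finest lattice, same Wilson weight, `fieldShift`):
§1 `fieldShift_preimage_levelEvent` / `sum_levelEvent_eq_refine`: the level-`j` single-plaquette tail events of run `J + d` of `F` ARE the level-`j`
   events of run `J` of `F.refine d` (plaquettes corresponding under `plaqShift`), and the sums over the plaquettes of a level agree;
§2 `fieldShift_preimage_unitEvent` / `gibbsK_real_unitEvent_eq_refine`: the same for the UNIT events `(unitA)⁻¹{t ≤ |V(∂p) − 1|}` of the refined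
   family (the events of the crux `LocalUnitStabilityL`, stmt-QuantumFields-27016), `unitA = unitShift ∘ avg^J`;
§3 `refine_real_compl_histGoodInt_le`: the Gibbs mass (run `J` of `F.refine d`) of the COMPLEMENT of the interior event
   `histGoodInt (F.refine d) θ_{b₀} (θ_{c b₀}(n)) J n` is at most the sum, over the constrained levels `j ≤ J − n` and their plaquettes and over
   the plaquettes of the window level `J − n`, of the per-plaquette tails of run `J + d` of `F` at the SCALED profile `c·b₀` (`c ≤ 1`: a
   `b₀`-large plaquette is `c b₀`-large) — every conditioning defect of the chain is a unit tail of a deeper family at a smaller cut-off.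

HONEST FRAMING.  Transport and union bounds over the tree's definitions; no estimate of Bałaban's is asserted; the crux 27016 is untouched; rung
R3 is a RECORD rung — no summit, no Clay claim; the Yang–Mills mass gap is NOT proved by any of this.  No `def`, no `sorry`.

References: T. Bałaban, CMP **102** (1985) 255–275 [Balaban1985UV3] ((1)–(3) p.256, (7) p.257); CMP **109** (1987) 249–301 [Balaban1987RG1]
((0.4)/(0.11) p.253).
-/

set_option autoImplicit false

noncomputable section

open MeasureTheory
open scoped BigOperators
open Literature.MathematicalPhysics.QuantumFieldTheory
open Literature.MathematicalPhysics.QuantumFieldTheory.Balaban1983to89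
open Literature.MathematicalPhysics.QuantumFieldTheory.Balaban1983to89.T3ContinuumYM3Torus
open Literature.MathematicalPhysics.QuantumFieldTheory.Balaban1983to89.T3UnitScaleTilt
open Literature.MathematicalPhysics.QuantumFieldTheory.Balaban1983to89.T3UnitLawDensityEML
open Literature.MathematicalPhysics.QuantumFieldTheory.Balaban1983to89.T3LevelShift
open Literature.MathematicalPhysics.QuantumFieldTheory.Balaban1983to89.T3ThresholdRemoval
open Literature.MathematicalPhysics.QuantumFieldTheory.Balaban1983to89.T3InteriorExcision
open Literature.MathematicalPhysics.QuantumFieldTheory.Balaban1983to89.T3HistoryTailReduction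
open Literature.MathematicalPhysics.QuantumFieldTheory.Balaban1983to89.T3CruxEstimates
open Summit.QuantumFields.YangMills.Theorems.LargeFieldMassRefinementTailOfHeightTail (θBal_mul_pow plaqSmall_fieldShift_iff)
open Summit.QuantumFields.YangMills.Theorems.RenyiTelescope (gibbsK_real_eq_refine plaqShift_plaqShift sitesPerDir_level_refine_unit
  θBal_scaled_le)

namespace Summit.QuantumFields.YangMills.Theorems.HistoryTailOfLocalStability

/-! ## §1 Level-`j` single-plaquette events: run `J + d` of `F` versus run `J` of `F.refine d` -/

section Level

variable (F : T3Family)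

/-- The single-plaquette tail event of a block-averaged field is measurable. [cite: Balaban1985UV3, (7) p.257] -/
theorem measurableSet_levelEvent (K j : ℕ) (t : ℝ) (q : Plaq (F.P K) j) :
    MeasurableSet {U : GaugeField (F.P K) 0 (Matrix.specialUnitaryGroup (Fin 2) ℂ) |
      t ≤ GaugeGroup.dist1 (GaugeField.plaqHol
        (Averaging.iter (fun i => BlockAveraging.blockAvg (P := F.P K) (j := i) ℰp) j U) q)} :=
  measurableSet_le measurable_const (RegularGaugeGroup.measurable_dist1.comp ((Missing.measurable_plaqHol q).comp
    (T4Continuum.measurable_iter _ (F.avgMeasurable_of_measurableE ℰp measurableE_ℰp K) j)))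

/-- **THE LEVEL-`j` EVENT IDENTIFICATION**: read through `fieldShift` on run `J` of `F.refine d`, the event «`t ≤ |Ū^{j}(∂q) − 1|`» of run `J + d`
of `F` (plaquette `q` of level `j`) is the event «`t ≤ |Ū^{j}(∂q') − 1|`» of run `J` of `F.refine d` at the corresponding plaquette
`q' = plaqShift q` (`iter_fieldShift`, `plaqHol_fieldShift`). [cite: Balaban1985UV3, (1)-(3) p.256; Balaban1987RG1, (0.11) p.253] -/
theorem fieldShift_preimage_levelEvent (d J j : ℕ) (t : ℝ) (q : Plaq (F.P (J + d)) j) :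
    fieldShift (G := Matrix.specialUnitaryGroup (Fin 2) ℂ) (sitesPerDir_refine_zero F d J) ⁻¹'
        {U | t ≤ GaugeGroup.dist1 (GaugeField.plaqHol
          (Averaging.iter (fun i => BlockAveraging.blockAvg (P := F.P (J + d)) (j := i) ℰp) j U) q)} =
      {V : GaugeField ((F.refine d).P J) 0 (Matrix.specialUnitaryGroup (Fin 2) ℂ) |
        t ≤ GaugeGroup.dist1 (GaugeField.plaqHol
          (Averaging.iter (fun i => BlockAveraging.blockAvg (P := (F.refine d).P J) (j := i) ℰp) j V)
          (plaqShift (F.sitesPerDir_eq (m := F.m) (K := J + d) (j := j) (m' := F.m + d) (K' := J) (j' := j) (by omega)) q))} := by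
  ext V
  have hmK : F.m + (J + d) = F.m + d + J := by omega
  have key := iter_fieldShift ℰp hmK j V
  constructor
  · intro hV
    have h1 : t ≤ GaugeGroup.dist1 (GaugeField.plaqHol
        (Averaging.iter (fun i => BlockAveraging.blockAvg (P := F.P (J + d)) (j := i) ℰp) j
          (fieldShift (sitesPerDir_refine_zero F d J) V)) q) := hV
    erw [key, plaqHol_fieldShift] at h1
    exact h1
  · intro hV
    show t ≤ GaugeGroup.dist1 (GaugeField.plaqHol
        (Averaging.iter (fun i => BlockAveraging.blockAvg (P := F.P (J + d)) (j := i) ℰp) j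
          (fieldShift (sitesPerDir_refine_zero F d J) V)) q)
    erw [key, plaqHol_fieldShift]
    exact hV

/-- **THE LEVEL SUMS AGREE**: `Σ_{q' ∈ T^{(j)} of run J of F.refine d} Gibbs'{t ≤ |Ū^{j}(∂q') − 1|} = Σ_{q ∈ T^{(j)} of run J+d of F} Gibbs{t ≤ |Ū^{j}(∂q) − 1|}`
(`gibbsK_real_eq_refine` termwise, reindexing by `plaqShift`). [cite: Balaban1985UV3, (1)-(3) p.256] -/
theorem sum_levelEvent_eq_refine {γ : ℝ} (hγ : 0 ≤ γ) (d J j : ℕ) (t : ℝ) :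
    ∑ q' : Plaq ((F.refine d).P J) j, (gibbsK (F.refine d) ℰp (γ * ((F.L : ℝ)⁻¹) ^ d) J).real
        {V | t ≤ GaugeGroup.dist1 (GaugeField.plaqHol
          (Averaging.iter (fun i => BlockAveraging.blockAvg (P := (F.refine d).P J) (j := i) ℰp) j V) q')} =
      ∑ q : Plaq (F.P (J + d)) j, (gibbsK F ℰp γ (J + d)).real
        {U | t ≤ GaugeGroup.dist1 (GaugeField.plaqHol
          (Averaging.iter (fun i => BlockAveraging.blockAvg (P := F.P (J + d)) (j := i) ℰp) j U) q)} := by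
  symm
  refine Fintype.sum_equiv (plaqShift (F.sitesPerDir_eq (m := F.m) (K := J + d) (j := j) (m' := F.m + d) (K' := J) (j' := j)
    (by omega)) : Plaq (F.P (J + d)) j ≃ Plaq ((F.refine d).P J) j) _ _ fun q => ?_
  rw [gibbsK_real_eq_refine F ℰp hγ d J (measurableSet_levelEvent F (J + d) j t q)]
  exact congrArg (fun S => (gibbsK (F.refine d) ℰp (γ * ((F.L : ℝ)⁻¹) ^ d) J).real S)
    (fieldShift_preimage_levelEvent F d J j t q)

end Level

/-! ## §2 Unit events of the refined family -/

section Unit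

variable (F : T3Family)

/-- **THE UNIT EVENT IDENTIFICATION**: read through `fieldShift`, the event «`t ≤ |Ū^{J}(∂a) − 1|`» of run `J + d` of `F` (plaquette `a` of level
`J`) is the crux's unit event `(unitA (F.refine d) J)⁻¹{t ≤ |V(∂(plaqShift a)) − 1|}` of run `J` of `F.refine d` (`unitA = unitShift ∘ avg^{J}`,
`plaqShift_plaqShift`). [cite: Balaban1987RG1, (0.4)/(0.11) p.253] -/
theorem fieldShift_preimage_unitEvent (d J : ℕ) (t : ℝ) (a : Plaq (F.P (J + d)) J) :
    fieldShift (G := Matrix.specialUnitaryGroup (Fin 2) ℂ) (sitesPerDir_refine_zero F d J) ⁻¹'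
        {U | t ≤ GaugeGroup.dist1 (GaugeField.plaqHol
          (Averaging.iter (fun i => BlockAveraging.blockAvg (P := F.P (J + d)) (j := i) ℰp) J U) a)} =
      (unitA (F.refine d) ℰp J) ⁻¹'
        {V | t ≤ GaugeGroup.dist1 (GaugeField.plaqHol V (plaqShift (sitesPerDir_level_refine_unit F d J) a))} := by
  ext V
  have hmK : F.m + (J + d) = F.m + d + J := by omega
  have key := iter_fieldShift ℰp hmK J V
  constructor
  · intro hV
    have h1 : t ≤ GaugeGroup.dist1 (GaugeField.plaqHol
        (Averaging.iter (fun i => BlockAveraging.blockAvg (P := F.P (J + d)) (j := i) ℰp) J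
          (fieldShift (sitesPerDir_refine_zero F d J) V)) a) := hV
    erw [key, plaqHol_fieldShift] at h1
    show t ≤ GaugeGroup.dist1 (GaugeField.plaqHol (fieldShift ((F.refine d).sitesPerDir_unit J)
      (Averaging.iter (fun i => BlockAveraging.blockAvg (P := (F.refine d).P J) (j := i) ℰp) J V))
      (plaqShift (sitesPerDir_level_refine_unit F d J) a))
    erw [plaqHol_fieldShift, plaqShift_plaqShift]
    exact h1
  · intro hV
    have h1 : t ≤ GaugeGroup.dist1 (GaugeField.plaqHol (fieldShift ((F.refine d).sitesPerDir_unit J)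
        (Averaging.iter (fun i => BlockAveraging.blockAvg (P := (F.refine d).P J) (j := i) ℰp) J V))
        (plaqShift (sitesPerDir_level_refine_unit F d J) a)) := hV
    erw [plaqHol_fieldShift, plaqShift_plaqShift] at h1
    show t ≤ GaugeGroup.dist1 (GaugeField.plaqHol
        (Averaging.iter (fun i => BlockAveraging.blockAvg (P := F.P (J + d)) (j := i) ℰp) J
          (fieldShift (sitesPerDir_refine_zero F d J) V)) a)
    erw [key, plaqHol_fieldShift]
    exact h1

/-- The crux's unit events are measurable. [cite: Balaban1987RG1, (0.4)/(0.11) p.253] -/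
theorem measurableSet_unitEvent (F' : T3Family) (J : ℕ) (t : ℝ) (p : Plaq (F'.P 0) 0) :
    MeasurableSet ((unitA F' ℰp J) ⁻¹'
      {V : GaugeField (F'.P 0) 0 (Matrix.specialUnitaryGroup (Fin 2) ℂ) | t ≤ GaugeGroup.dist1 (GaugeField.plaqHol V p)}) :=
  measurable_unitA F' ℰp measurableE_ℰp J
    (measurableSet_le measurable_const (RegularGaugeGroup.measurable_dist1.comp (Missing.measurable_plaqHol p)))

/-- **THE UNIT MASS IDENTIFICATION**: `Gibbs^{F,γ}_{J+d}{t ≤ |Ū^{J}(∂a) − 1|} = Gibbs^{F.refine d, γL^{-d}}_J((unitA)⁻¹{t ≤ |V(∂(plaqShift a)) − 1|})`.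
[cite: Balaban1985UV3, (1)-(3) p.256; Balaban1987RG1, (0.11) p.253] -/
theorem gibbsK_real_unitEvent_eq_refine {γ : ℝ} (hγ : 0 ≤ γ) (d J : ℕ) (t : ℝ) (a : Plaq (F.P (J + d)) J) :
    (gibbsK F ℰp γ (J + d)).real
        {U | t ≤ GaugeGroup.dist1 (GaugeField.plaqHol
          (Averaging.iter (fun i => BlockAveraging.blockAvg (P := F.P (J + d)) (j := i) ℰp) J U) a)} =
      (gibbsK (F.refine d) ℰp (γ * ((F.L : ℝ)⁻¹) ^ d) J).real ((unitA (F.refine d) ℰp J) ⁻¹'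
        {V | t ≤ GaugeGroup.dist1 (GaugeField.plaqHol V (plaqShift (sitesPerDir_level_refine_unit F d J) a))}) := by
  rw [gibbsK_real_eq_refine F ℰp hγ d J (measurableSet_levelEvent F (J + d) J t a)]
  exact congrArg (fun S => (gibbsK (F.refine d) ℰp (γ * ((F.L : ℝ)⁻¹) ^ d) J).real S)
    (fieldShift_preimage_unitEvent F d J t a)

/-- The same read from the refined family's side: for every unit plaquette `p` of `F.refine d` the crux's unit event of run `J` has the Gibbs
mass of the level-`J` event of run `J + d` of `F` at `a = plaqShift⁻¹ p`. [cite: Balaban1985UV3, (1)-(3) p.256; Balaban1987RG1, (0.11) p.253] -/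
theorem gibbsK_refine_real_unitEvent_eq {γ : ℝ} (hγ : 0 ≤ γ) (d J : ℕ) (t : ℝ) (p : Plaq ((F.refine d).P 0) 0) :
    (gibbsK (F.refine d) ℰp (γ * ((F.L : ℝ)⁻¹) ^ d) J).real ((unitA (F.refine d) ℰp J) ⁻¹'
        {V | t ≤ GaugeGroup.dist1 (GaugeField.plaqHol V p)}) =
      (gibbsK F ℰp γ (J + d)).real
        {U | t ≤ GaugeGroup.dist1 (GaugeField.plaqHol
          (Averaging.iter (fun i => BlockAveraging.blockAvg (P := F.P (J + d)) (j := i) ℰp) J U)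
          ((plaqShift (sitesPerDir_level_refine_unit F d J)).symm p))} := by
  rw [gibbsK_real_unitEvent_eq_refine F hγ d J t, Equiv.apply_symm_apply]

end Unit

/-! ## §3 The interior complements are covered by per-plaquette tails of the base family -/

section Interior

variable (F : T3Family)

/-- **THE HISTORY PART**: the Gibbs mass (run `J` of `F.refine d` at `γL^{-d}`) of the complement of the UV-small history `histGood (F.refine d) θ_{b} J n`
(`θ_b = θBal L (γL^{-d}) b p₀`, i.e. `θBal L γ b p₀ (· + d)`) is at most the sum over the constrained levels `j ≤ J − n` and their plaquettes `q` of
the per-plaquette tails `Gibbs^{F}_{J+d}{θBal L γ b p₀ (J + d − j) ≤ |Ū^{j}(∂q) − 1|}` of run `J + d` of `F` — union bound over heights and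
plaquettes (`real_compl_histGood_le_sum`, `real_not_plaqSmall_comp_le_sum`) and §1. [cite: Balaban1985UV3, (7) p.257] -/
theorem refine_real_compl_histGood_le_sum {γ : ℝ} (hγ : 0 ≤ γ) (b p₀ : ℝ) (d J n : ℕ) :
    (gibbsK (F.refine d) ℰp (γ * ((F.L : ℝ)⁻¹) ^ d) J).real
        (histGood (F.refine d) ℰp (θBal F.L (γ * ((F.L : ℝ)⁻¹) ^ d) b p₀) J n)ᶜ ≤
      ∑ j ∈ Finset.range (J - n + 1), ∑ q : Plaq (F.P (J + d)) j, (gibbsK F ℰp γ (J + d)).real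
        {U | θBal F.L γ b p₀ (J + d - j) ≤ GaugeGroup.dist1 (GaugeField.plaqHol
          (Averaging.iter (fun i => BlockAveraging.blockAvg (P := F.P (J + d)) (j := i) ℰp) j U) q)} := by
  have hγ' : 0 ≤ γ * ((F.L : ℝ)⁻¹) ^ d := mul_nonneg hγ (pow_nonneg (inv_nonneg.mpr (Nat.cast_nonneg _)) _)
  haveI := isProbabilityMeasure_gibbsK (F.refine d) ℰp hγ' J
  refine (real_compl_histGood_le_sum (F.refine d) ℰp (θBal F.L (γ * ((F.L : ℝ)⁻¹) ^ d) b p₀) J n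
    (gibbsK (F.refine d) ℰp (γ * ((F.L : ℝ)⁻¹) ^ d) J)).trans (Finset.sum_le_sum fun j hj => ?_)
  have hjJ : j ≤ J := by have := Finset.mem_range.mp hj; omega
  refine (real_not_plaqSmall_comp_le_sum (gibbsK (F.refine d) ℰp (γ * ((F.L : ℝ)⁻¹) ^ d) J)
    (fun V => Averaging.iter (fun i => BlockAveraging.blockAvg (P := (F.refine d).P J) (j := i) ℰp) j V)
    (θBal F.L (γ * ((F.L : ℝ)⁻¹) ^ d) b p₀ (J - j))).trans (le_of_eq ?_)
  rw [θBal_mul_pow, show J - j + d = J + d - j by omega]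
  exact sum_levelEvent_eq_refine F hγ d J j _

/-- **THE WINDOW PART**: the Gibbs mass (run `J` of `F.refine d`) of «the `(J − n)`-fold averaged field is NOT `θI`-small» is at most the sum over
the plaquettes `q` of level `J − n` of run `J + d` of `F` of `Gibbs^{F}_{J+d}{θI ≤ |Ū^{J−n}(∂q) − 1|}`. [cite: Balaban1985UV3, (7) p.257] -/
theorem refine_real_not_plaqSmall_le_sum {γ : ℝ} (hγ : 0 ≤ γ) (θI : ℝ) (d J k : ℕ) :
    (gibbsK (F.refine d) ℰp (γ * ((F.L : ℝ)⁻¹) ^ d) J).real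
        {V | ¬ PlaqSmall θI (Averaging.iter (fun i => BlockAveraging.blockAvg (P := (F.refine d).P J) (j := i) ℰp) k V)} ≤
      ∑ q : Plaq (F.P (J + d)) k, (gibbsK F ℰp γ (J + d)).real
        {U | θI ≤ GaugeGroup.dist1 (GaugeField.plaqHol
          (Averaging.iter (fun i => BlockAveraging.blockAvg (P := F.P (J + d)) (j := i) ℰp) k U) q)} := by
  have hγ' : 0 ≤ γ * ((F.L : ℝ)⁻¹) ^ d := mul_nonneg hγ (pow_nonneg (inv_nonneg.mpr (Nat.cast_nonneg _)) _)
  haveI := isProbabilityMeasure_gibbsK (F.refine d) ℰp hγ' J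
  refine (real_not_plaqSmall_comp_le_sum (gibbsK (F.refine d) ℰp (γ * ((F.L : ℝ)⁻¹) ^ d) J)
    (fun V => Averaging.iter (fun i => BlockAveraging.blockAvg (P := (F.refine d).P J) (j := i) ℰp) k V) θI).trans (le_of_eq ?_)
  exact sum_levelEvent_eq_refine F hγ d J k θI

/-- A `b₀`-large plaquette is `c·b₀`-large (`c ≤ 1`, `0 < γ ≤ 1`, `0 < b₀`): monotonicity of the per-plaquette tail events in the profile,
at the level of Gibbs masses. [cite: Balaban1985UV3, (7) p.257] -/
theorem real_levelEvent_mono_profile {γ b₀ c : ℝ} (hγ : 0 < γ) (hγ1 : γ ≤ 1) (hb₀ : 0 < b₀) (hc1 : c ≤ 1) (p₀ : ℝ)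
    (K j i : ℕ) (q : Plaq (F.P K) j) :
    (gibbsK F ℰp γ K).real
        {U | θBal F.L γ b₀ p₀ i ≤ GaugeGroup.dist1 (GaugeField.plaqHol
          (Averaging.iter (fun i' => BlockAveraging.blockAvg (P := F.P K) (j := i') ℰp) j U) q)} ≤
      (gibbsK F ℰp γ K).real
        {U | θBal F.L γ (c * b₀) p₀ i ≤ GaugeGroup.dist1 (GaugeField.plaqHol
          (Averaging.iter (fun i' => BlockAveraging.blockAvg (P := F.P K) (j := i') ℰp) j U) q)} := by
  haveI := isProbabilityMeasure_gibbsK F ℰp hγ.le K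
  refine measureReal_mono (fun U hU => ?_) (measure_ne_top _ _)
  exact (θBal_scaled_le F.hL.2.le hγ hγ1 hb₀ hc1 p₀ i).trans hU

/-- **THE INTERIOR COMPLEMENT IS COVERED BY PER-PLAQUETTE TAILS OF THE BASE FAMILY** (module docstring §3): for `0 < γ ≤ 1`, `0 < b₀`, `c ≤ 1`,
the Gibbs mass (run `J` of `F.refine d` at `γL^{-d}`) of the complement of `histGoodInt (F.refine d) θ'_{b₀} (θ'_{c b₀}(n)) J n` (`θ' = θBal L (γL^{-d}) · p₀`)
is at most `Σ_{j ≤ J−n} Σ_{q ∈ T^{(j)}} Gibbs^{F}_{J+d}{θBal L γ (c b₀) p₀ (J+d−j) ≤ |Ū^{j}(∂q) − 1|} + Σ_{q ∈ T^{(J−n)}} Gibbs^{F}_{J+d}{θBal L γ (c b₀) p₀ (J+d−(J−n)) ≤ |Ū^{J−n}(∂q) − 1|}`.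
[cite: Balaban1985UV3, (7) p.257] -/
theorem refine_real_compl_histGoodInt_le {γ b₀ c : ℝ} (hγ : 0 < γ) (hγ1 : γ ≤ 1) (hb₀ : 0 < b₀) (hc1 : c ≤ 1) (p₀ : ℝ)
    (d J n : ℕ) (hn : n ≤ J) :
    (gibbsK (F.refine d) ℰp (γ * ((F.L : ℝ)⁻¹) ^ d) J).real
        (histGoodInt (F.refine d) (θBal F.L (γ * ((F.L : ℝ)⁻¹) ^ d) b₀ p₀)
          (θBal F.L (γ * ((F.L : ℝ)⁻¹) ^ d) (c * b₀) p₀ n) J n)ᶜ ≤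
      (∑ j ∈ Finset.range (J - n + 1), ∑ q : Plaq (F.P (J + d)) j, (gibbsK F ℰp γ (J + d)).real
        {U | θBal F.L γ (c * b₀) p₀ (J + d - j) ≤ GaugeGroup.dist1 (GaugeField.plaqHol
          (Averaging.iter (fun i => BlockAveraging.blockAvg (P := F.P (J + d)) (j := i) ℰp) j U) q)}) +
      ∑ q : Plaq (F.P (J + d)) (J - n), (gibbsK F ℰp γ (J + d)).real
        {U | θBal F.L γ (c * b₀) p₀ (J + d - (J - n)) ≤ GaugeGroup.dist1 (GaugeField.plaqHol
          (Averaging.iter (fun i => BlockAveraging.blockAvg (P := F.P (J + d)) (j := i) ℰp) (J - n) U) q)} := by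
  have hγ' : 0 ≤ γ * ((F.L : ℝ)⁻¹) ^ d := mul_nonneg hγ.le (pow_nonneg (inv_nonneg.mpr (Nat.cast_nonneg _)) _)
  haveI := isProbabilityMeasure_gibbsK (F.refine d) ℰp hγ' J
  set μ := gibbsK (F.refine d) ℰp (γ * ((F.L : ℝ)⁻¹) ^ d) J with hμ
  -- the complement of the intersection is the union of the complements
  have hsplit : (histGoodInt (F.refine d) (θBal F.L (γ * ((F.L : ℝ)⁻¹) ^ d) b₀ p₀)
      (θBal F.L (γ * ((F.L : ℝ)⁻¹) ^ d) (c * b₀) p₀ n) J n)ᶜ =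
      (histGood (F.refine d) ℰp (θBal F.L (γ * ((F.L : ℝ)⁻¹) ^ d) b₀ p₀) J n)ᶜ ∪
        {V | ¬ PlaqSmall (θBal F.L (γ * ((F.L : ℝ)⁻¹) ^ d) (c * b₀) p₀ n)
          (Averaging.iter (fun i => BlockAveraging.blockAvg (P := (F.refine d).P J) (j := i) ℰp) (J - n) V)} := by
    unfold histGoodInt
    rw [Set.compl_inter]
    rfl
  rw [hsplit]
  refine (measureReal_union_le _ _).trans (add_le_add ?_ ?_)
  · -- the history part at profile `b₀`, then monotonicity to `c b₀`
    refine (refine_real_compl_histGood_le_sum F hγ.le b₀ p₀ d J n).trans ?_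
    exact Finset.sum_le_sum fun j _ => Finset.sum_le_sum fun q _ =>
      real_levelEvent_mono_profile F hγ hγ1 hb₀ hc1 p₀ (J + d) j (J + d - j) q
  · -- the window part
    refine (refine_real_not_plaqSmall_le_sum F hγ.le _ d J (J - n)).trans (le_of_eq ?_)
    rw [θBal_mul_pow, show n + d = J + d - (J - n) by omega]

end Interior

end Summit.QuantumFields.YangMills.Theorems.HistoryTailOfLocalStability

end
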